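import Summits.QuantumFields.YangMills.Theorems.FluctuationComparisonRegPrIntLS2BetaCoarseCurlRemainderCovariant
import Summits.QuantumFields.YangMills.Theorems.FluctuationComparisonRegPrIntLS2BetaCoarseCurlRowsRem
import HarnessLib

/-!
# S2β · (β-3)′ ∕ rows v2 — C₇b «ROWS v2, THE COVARIANT EDITION»: M-1‴'s `hR` and the (K5) rows with the COVARIANT order-2 source
# `R′ i x = 8B·(O i x)²∕(a − M i x)² + 32B·(O i x)(M i x)∕a² + (ℓ·M i x)³ + 8·(67ℓ·((d−1)·3L·δ_i))·(M i x)²∕a²` — NO bond size, NO `κ`; `O` = the read-cell oscillation of the datum in the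
# four-block axial gauge of the background (HAZARD «SRC-VOL-R» (q2) removed; what is left is (q1) in covariant form)

Cell `ym3-torus` (YM ladder rung R3 = continuum `SU(2)` Yang–Mills on the three-torus at fixed lattice data — a RUNG: NOT d = 4, NOT infinite volume, NOT a mass gap,
NOT Clay).  Width seat `ym3-torus-px13` (gen 28); crux `stmt-QuantumFields-20520`, LINE g18-1 S2β, pairing lane; (SCT″-c)₁; RULINGS «SRC-VOL» (R-b)(R-e)(R-f), «SRC-VOL (3)».
The tower∕rows editions of C₇a ✓`…CoarseCurlRemainderCovariant.norm_remainder_le_on_four_cov`, in M-1‴ ✓p835604's binder shapes (as C₆ ✓p837023∕✓p838015∕✓p838230 did for the raw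
edition): the consumer supplies the classes `α_i, α^p_i, δ_i` (θ), the sizes `M`, the COVARIANT oscillations `O` and one window radius `a`; nothing σ-class multiplies `M²` any more.
`--kind proof --supports stmt-QuantumFields-20520 --as helper`, count-neutral, DEFINITION-FREE (0 `def`, 0 `instance`, 0 `notation`, 0 `sorry`, default heartbeats); generic `P : Params`
(`r + 1 ≤ m + K`), `SU(N)`.

WHAT IS PROVED (sorry-free; `h_{i,y′}` = lit ✓`T4AxialGaugeSmallField.axialGauge (U i) lo hi` on the four-block box of `(y′; μ, ν)`, written out).
§1 ★★★`hR_cov` — M-1‴'s hypothesis `hR` VERBATIM with `R := fun i x => R′(O i x, M i x, δ_i)`; per level `i < r`: loop guards `α_{i+1}`, `PlaqSmall δ_{i+1} (U i)`, `100ℓ·((d−1)·3L·δ_{i+1}) ≤ ρ`,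
   sizes `‖X i b‖ ≤ M (i+1) y′` and COVARIANT oscillations `‖h_{i,y′}(b₋)·↑(X i b)·h_{i,y′}(b₋)⋆ − ↑(Aref i y′ (b.dir))‖ ≤ O (i+1) y′` on the four corner blocks, `‖Aref i y′‖ ≤ M (i+1) y′`,
   `8M ≤ a`, `8·O ≤ a`, `100ℓ(e^a − 1) ≤ ρ`.
§2 ★★★**`rows_K5_cov`** — ✓p835604 `rows_LL_tower_of_remainder_K5` ∘ §1 by `exact`: px16's (K5) ∕ ✓`weighted_readMax_sq_le_sources` ∕ ✓p835103 `rows_rescale` row binders VERBATIM for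
   `ρ i x = ‖Y_{U i}(∂q_x)[X̂ i]‖` with `src i x = lin(M i x) + 4·R′ i x + 2δ_i·L²·M i x`.
§3 ★★★**`rows_K5_cov_osc`** — the PAIRWISE edition: `Aref i y′ κ := Ad_{h_{i,y′}(emb y′)} X i ⟨emb y′, κ⟩` chosen inside (lit ✓`Site.blockOf_emb`), ONE letter
   **`hOSC : ‖h(b₋)·↑(X i b)·h(b₋)⋆ − h(b′₋)·↑(X i b′)·h(b′₋)⋆‖ ≤ O (i+1) y′`** for same-direction bonds issuing from the four corner blocks (`= ‖↑(X i b) − Ad_{h(b₋)⁻¹h(b′₋)}↑(X i b′)‖`: the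
   difference after the background's parallel transport along the box comb — the COVARIANT read-cell oscillation that (q1) asks px12's OSC-LIFT to price by (BKG∕ρ)-class quantities).

HONEST.  Composition of landed files (C₇a, M-1‴); nothing of Bałaban's analysis is asserted or proved ([Balaban1985Averaging] Prop. 1∕3∕4, [Balaban1987RG1] (0.3)–(0.4) are the printed loci);
(q1), budgets, (E5), G4-ii, (ST‴), (SCT″-c)₁₂₃, LOC‴, GAP♯∘ (`stub_uniformFibreGapOrbit`, registry 3732b7df UNTOUCHED, 0∕5), the five REGISTERED stubs, S2β, crux 20520, 19936, 19200,
`YM3TorusSU2` — NOT proved; no summit statement is proved by a helper; rung R3 = SU(2) YM₃ on T³ at fixed lattice data — NOT d = 4, NOT infinite volume, NOT a mass gap, NOT Clay; the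
Yang–Mills mass gap is NOT proved.  Axioms standard.

References: [Balaban1985Averaging] T. Bałaban, CMP **98** (1985) 17–51, p.19, pp.24–25, Prop. 1 (51) p.26, Prop. 3 (121)–(126) p.36, Prop. 4 (128)–(135) pp.37–38, (148)–(149) p.40;
[Balaban1987RG1] CMP **109** (1987) 249–301, (0.1)–(0.4), (0.8), (0.18) pp.251–255.
-/

set_option autoImplicit false

noncomputable section

open scoped Matrix.Norms.L2Operator Topology
open Filter Set Function Metric

namespace Summit.QuantumFields.YangMills.Theorems.FluctuationComparisonRegPrIntLS2BetaCoarseCurlRowsCovariant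

open Literature.MathematicalPhysics.QuantumFieldTheory.Balaban1983to89
open Literature.MathematicalPhysics.QuantumFieldTheory.Balaban1983to89.HaarExponentialChart
open Literature.MathematicalPhysics.QuantumFieldTheory.Balaban1983to89.HaarExponentialChart.IsChartRep
open Literature.MathematicalPhysics.QuantumFieldTheory.Balaban1983to89.BlockAveraging (Small Idx avgFun loopHol off corr off_bounds)
open Literature.MathematicalPhysics.QuantumFieldTheory.Balaban1983to89.ExpMeanLog (eml expMeanLogSU deltaSU deltaSU_pos)
open Literature.MathematicalPhysics.QuantumFieldTheory.Balaban1983to89.Node00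
open Literature.MathematicalPhysics.QuantumFieldTheory.Balaban1983to89.T4Continuum (walk holAt LStep loopWord Letter)
open Literature.MathematicalPhysics.QuantumFieldTheory.Balaban1983to89.BlockAveragingEMLProp2 (shift_shift_comm)
open Literature.MathematicalPhysics.QuantumFieldTheory.Balaban1983to89.BlockAveragingEMLLinearisedBackground (covWalkSum)
open Literature.MathematicalPhysics.QuantumFieldTheory.Balaban1983to89.B10Eq47AxialChi (shiftN)
open Literature.MathematicalPhysics.QuantumFieldTheory.Balaban1983to89.B10Eq27TorusAxialLog (rel transl transl_apply transl_rel)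
open Literature.MathematicalPhysics.QuantumFieldTheory.Balaban1983to89.B7Prop1Local (InBox)
open Literature.MathematicalPhysics.QuantumFieldTheory.Balaban1983to89.B7Prop1Explicit (e e_apply)
open Literature.MathematicalPhysics.QuantumFieldTheory.Balaban1983to89.T4AxialGaugeSmallField (castSite castSite_apply boxBonds boxPlaqs axialGauge dist1_gaugeAct_axialGauge_le_of_mem_boxBonds)
open Literature.MathematicalPhysics.QuantumFieldTheory.Balaban1983to89.BlockAveragingSectionQsstar (eq_blockSite_blockEquiv)
open Summit.QuantumFields.YangMills.BalabanUVNodes.N09ChartReadAveragingSmooth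
open Summit.QuantumFields.YangMills.Theorems.FluctuationComparisonRegPrIntLS2BetaChartReadCplxExtension (innerRadius_le_deltaSU)
open Summit.QuantumFields.YangMills.Theorems.FluctuationComparisonRegPrIntLS2BetaCovWalkSumStokes (norm_coe_conj_le)
open Summit.QuantumFields.YangMills.Theorems.FluctuationComparisonRegPrIntLS2BetaChartReadDerivLocal (chartRead_apply_local fderiv_chartRead_apply_local)
open Summit.QuantumFields.YangMills.Theorems.FluctuationComparisonRegPrIntLS2BetaChartReadBkgLipschitz (norm_chartRead_sub_fderiv_le_curved_osc)
open Summit.QuantumFields.YangMills.Theorems.FluctuationComparisonRegPrIntLS2BetaChartReadGaugeCovariance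
open Summit.QuantumFields.YangMills.Theorems.FluctuationComparisonRegPrIntLS2BetaChartReadCurvedOfPlaqSmall (two_mul_lt_sitesPerDir)
open YMDAG.N18.TransportOfRecord (rel_emb_blockSite rel_emb_blockSite_shift rel_emb_blockSite_shift_shift two_mul_sq_le_sitesPerDir)
open Summit.QuantumFields.YangMills.Theorems.FluctuationComparisonRegPrIntLS2BetaCoarseCurlRemainderCovariant (norm_remainder_le_on_four_cov)

variable {P : Params} {j : ℕ} {N : ℕ} [NeZero N]

/-! ## §1 ★★★ The tower edition: M-1‴'s letter `hR` VERBATIM with the COVARIANT formula `R′` -/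

section Tower

/-- ★★★ **R-DISCHARGE, COVARIANT, TOWER EDITION — ✓p835604 `rows_LL_tower_of_remainder(_K5)`'s hypothesis `hR` INHABITED** with
`R′ i x := 8B·(O i x)²∕(a − M i x)² + 32B·(O i x)·(M i x)∕a² + (ℓ·M i x)³ + 8·(67ℓ·((d−1)·3L·δ_i))·(M i x)²∕a²` — NO bond size, NO `κ`; per level `i < r` (`r + 1 ≤ m + K`): loop guards,
`PlaqSmall δ_{i+1} (U i)`, local sizes `M (i+1) y′`, free reference data `Aref i y′` (`‖Aref i y′‖ ≤ M (i+1) y′`) and the COVARIANT oscillation letter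
`‖h_{i,y′}(b₋)·↑(X i b)·h_{i,y′}(b₋)⋆ − ↑(Aref i y′ (b.dir))‖ ≤ O (i+1) y′` on the four corner blocks, `h_{i,y′}` = the four-block axial gauge of `U i` at `(y′; μ, ν)` (written out).
[cite: Balaban1985Averaging, p.19, pp.24-25, Prop. 3 (121)-(125) p.36, Prop. 4 (128)-(135) pp.37-38; Balaban1987RG1, (0.3)-(0.4) pp.252-253] -/
theorem hR_cov {μ ν : Fin P.d} (r : ℕ) (hr2 : r + 1 ≤ P.m + P.K)
    (U : (i : ℕ) → GaugeField P i (SU N)) (X : (i : ℕ) → PBond P i → (specialUnitaryLogChart (Fin N)).lie)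
    {ρr : ℝ} (hρ0 : 0 < ρr) (hρr : ρr ≤ innerRadius (specialUnitaryLogChart (Fin N)))
    (α δ : ℕ → ℝ)
    (hα : ∀ i, i < r → ∀ (c : PBond P (i + 1)) (ι : Idx P), dist1 (loopHol (U i) c ι) ≤ α (i + 1))
    (hα4 : ∀ i, i < r → 4 * α (i + 1) ≤ ρr)
    (hδ : ∀ i, i < r → 0 ≤ δ (i + 1)) (hUs : ∀ i, i < r → PlaqSmall (δ (i + 1)) (U i))
    (hδℓ : ∀ i, i < r → 100 * ((((P.d + 2) * P.L : ℕ) : ℝ) * (((P.d - 1 : ℕ) : ℝ) * ((3 * P.L : ℕ) : ℝ) * δ (i + 1))) ≤ ρr)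
    {a : ℝ} (ha0 : 0 < a) (ha : 100 * ((((P.d + 2) * P.L : ℕ) : ℝ) * (Real.exp a - 1)) ≤ ρr)
    (M O : (i : ℕ) → Site P i → ℝ) (Aref : (i : ℕ) → Site P (i + 1) → Fin P.d → (specialUnitaryLogChart (Fin N)).lie)
    (hO0 : ∀ i, i < r → ∀ y' : Site P (i + 1), 0 ≤ O (i + 1) y')
    (hAM : ∀ i, i < r → ∀ y' : Site P (i + 1), ‖Aref i y'‖ ≤ M (i + 1) y')
    (hMa : ∀ i, i < r → ∀ y' : Site P (i + 1), 8 * M (i + 1) y' ≤ a)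
    (hOa : ∀ i, i < r → ∀ y' : Site P (i + 1), 8 * O (i + 1) y' ≤ a)
    (hXM : ∀ i, i < r → ∀ (y' : Site P (i + 1)) (b : PBond P i), (blockOf b.src = y' ∨ blockOf b.src = y'.shift μ ∨ blockOf b.src = y'.shift ν ∨ blockOf b.src = (y'.shift μ).shift ν) → ‖X i b‖ ≤ M (i + 1) y')
    (hXO : ∀ i, i < r → ∀ (y' : Site P (i + 1)) (b : PBond P i), (blockOf b.src = y' ∨ blockOf b.src = y'.shift μ ∨ blockOf b.src = y'.shift ν ∨ blockOf b.src = (y'.shift μ).shift ν) →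
      ‖(((T4AxialGaugeSmallField.axialGauge (U i) (fun κ : Fin P.d => (((emb y' κ).val : ℕ) : ℤ) - (((P.L - 1) / 2 : ℕ) : ℤ)) (fun κ : Fin P.d => (((emb y' κ).val : ℕ) : ℤ) + (((if κ = μ then (P.L : ℤ) else 0) + (if κ = ν then (P.L : ℤ) else 0)) + (((P.L - 1) / 2 : ℕ) : ℤ)) + 1)) b.src : SU N) : Matrix (Fin N) (Fin N) ℂ) * ((X i b : (specialUnitaryLogChart (Fin N)).lie) : Matrix (Fin N) (Fin N) ℂ) * star (((T4AxialGaugeSmallField.axialGauge (U i) (fun κ : Fin P.d => (((emb y' κ).val : ℕ) : ℤ) - (((P.L - 1) / 2 : ℕ) : ℤ)) (fun κ : Fin P.d => (((emb y' κ).val : ℕ) : ℤ) + (((if κ = μ then (P.L : ℤ) else 0) + (if κ = ν then (P.L : ℤ) else 0)) + (((P.L - 1) / 2 : ℕ) : ℤ)) + 1)) b.src : SU N) : Matrix (Fin N) (Fin N) ℂ) - ((Aref i y' b.dir : (specialUnitaryLogChart (Fin N)).lie) : Matrix (Fin N) (Fin N) ℂ)‖ ≤ O (i + 1) y') :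
    ∀ i, i < r → ∀ (y' : Site P (i + 1)) (c : PBond P (i + 1)), (c = ⟨y', μ⟩ ∨ c = ⟨y'.shift μ, ν⟩ ∨ c = ⟨y'.shift ν, μ⟩ ∨ c = ⟨y', ν⟩) →
      ‖(((isChartRep_specialUnitaryGroup (n := Fin N)).logChart (avgFun (expMeanLogSU (n := Fin N)) (fun b => (isChartRep_specialUnitaryGroup (n := Fin N)).expChart (X i b) * U i b) c * (avgFun (expMeanLogSU (n := Fin N)) (U i) c)⁻¹) : (specialUnitaryLogChart (Fin N)).lie) : Matrix (Fin N) (Fin N) ℂ) -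
        ((fderiv ℝ (fun (A : PBond P i → (specialUnitaryLogChart (Fin N)).lie) (c : PBond P (i + 1)) => (isChartRep_specialUnitaryGroup (n := Fin N)).logChart (avgFun (expMeanLogSU (n := Fin N)) (fun b => (isChartRep_specialUnitaryGroup (n := Fin N)).expChart (A b) * U i b) c * (avgFun (expMeanLogSU (n := Fin N)) (U i) c)⁻¹)) 0 (X i) c : (specialUnitaryLogChart (Fin N)).lie) : Matrix (Fin N) (Fin N) ℂ)‖ ≤
      (fun (i : ℕ) (x : Site P i) => 8 * (54 * ((((P.d + 2) * P.L : ℕ) : ℝ) * (Real.exp a - 1))) * O i x ^ 2 / (a - M i x) ^ 2 +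
        32 * (54 * ((((P.d + 2) * P.L : ℕ) : ℝ) * (Real.exp a - 1))) * O i x * M i x / a ^ 2 +
        ((((P.d + 2) * P.L : ℕ) : ℝ) * M i x) ^ 3 + 8 * (67 * ((((P.d + 2) * P.L : ℕ) : ℝ) * (((P.d - 1 : ℕ) : ℝ) * ((3 * P.L : ℕ) : ℝ) * δ i))) * M i x ^ 2 / a ^ 2) (i + 1) y' := by
  intro i hi y' c hc
  exact norm_remainder_le_on_four_cov (by omega) (U i) hρ0 hρr (hα i hi) (hα4 i hi) (hδ i hi) (hUs i hi) (hδℓ i hi) ha0 ha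
    (X i) y' (Aref i y') (hO0 i hi y') (hAM i hi y') (hMa i hi y') (hOa i hi y') (hXM i hi y') (hXO i hi y') c hc

end Tower

/-! ## §2 ★★★ ROWS v2, COVARIANT: the (K5) rows with the explicit source `R′` — no remainder letter, no gauge LETTER, no bond size -/

section RowsCov

/-- ★★★ **ROWS v2, COVARIANT EDITION**: ✓p835604 `rows_LL_tower_of_remainder_K5` ∘ §3 — px16's (K5) ∕ ✓`weighted_readMax_sq_le_sources` ∕ ✓p835103 `rows_rescale` row binders VERBATIM for
`ρ i x = ‖Y_{U i}(∂q_x)[X̂ i]‖`, source `src i x = lin(M i x) + 4·R′ i x + 2δ_i·L²·M i x` with `R′` the COVARIANT formula (no `κ`, no `β`). [cite: Balaban1985Averaging, Prop. 1 (51) p.26, Prop. 3 (121)-(126) p.36, Prop. 4 (128)-(135) pp.37-38, (148)-(149) p.40; Balaban1987RG1, (0.3)-(0.4), (0.8), (0.18) pp.252-255] -/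
theorem rows_K5_cov {μ ν : Fin P.d} (hμν : μ ≠ ν) (r : ℕ) (hr2 : r + 1 ≤ P.m + P.K)
    (U : (i : ℕ) → GaugeField P i (SU N)) (X : (i : ℕ) → PBond P i → (specialUnitaryLogChart (Fin N)).lie)
    (hU : ∀ i, i < r → U (i + 1) = avgFun (expMeanLogSU (n := Fin N)) (U i))
    (hX : ∀ i, i < r → X (i + 1) = fun c : PBond P (i + 1) => (isChartRep_specialUnitaryGroup (n := Fin N)).logChart
        (avgFun (expMeanLogSU (n := Fin N)) (fun b => (isChartRep_specialUnitaryGroup (n := Fin N)).expChart (X i b) * U i b) c *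
          (avgFun (expMeanLogSU (n := Fin N)) (U i) c)⁻¹))
    (α δ αp : ℕ → ℝ)
    (hα : ∀ i, i < r → ∀ (c : PBond P (i + 1)) (ι : Idx P), dist1 (loopHol (U i) c ι) ≤ α (i + 1))
    (hα24 : ∀ i, i < r → α (i + 1) ≤ 1 / 24) (hαδ : ∀ i, i < r → α (i + 1) < deltaSU (Fin N))
    (hδ : ∀ i, i < r → 0 ≤ δ (i + 1)) (hUs : ∀ i, i < r → PlaqSmall (δ (i + 1)) (U i))
    (hαp : ∀ i, i < r → ∀ y' : Site P (i + 1),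
      dist1 (holAt (avgFun (expMeanLogSU (n := Fin N)) (U i)) (walk y' [((μ, true) : Letter P.d), (ν, true), (μ, false), (ν, false)])) ≤ αp (i + 1))
    (M : (i : ℕ) → Site P i → ℝ) (hM : ∀ i, i < r → ∀ y' : Site P (i + 1), 0 ≤ M (i + 1) y')
    (hXM : ∀ i, i < r → ∀ (y' : Site P (i + 1)) (b : PBond P i),
      (blockOf b.src = y' ∨ blockOf b.src = y'.shift μ ∨ blockOf b.src = y'.shift ν ∨ blockOf b.src = (y'.shift μ).shift ν) → ‖X i b‖ ≤ M (i + 1) y')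
    {ρr : ℝ} (hρ0 : 0 < ρr) (hρr : ρr ≤ innerRadius (specialUnitaryLogChart (Fin N))) (hα4 : ∀ i, i < r → 4 * α (i + 1) ≤ ρr)
    (hδℓ : ∀ i, i < r → 100 * ((((P.d + 2) * P.L : ℕ) : ℝ) * (((P.d - 1 : ℕ) : ℝ) * ((3 * P.L : ℕ) : ℝ) * δ (i + 1))) ≤ ρr)
    {a : ℝ} (ha0 : 0 < a) (ha : 100 * ((((P.d + 2) * P.L : ℕ) : ℝ) * (Real.exp a - 1)) ≤ ρr)
    (O : (i : ℕ) → Site P i → ℝ) (Aref : (i : ℕ) → Site P (i + 1) → Fin P.d → (specialUnitaryLogChart (Fin N)).lie)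
    (hO0 : ∀ i, i < r → ∀ y' : Site P (i + 1), 0 ≤ O (i + 1) y')
    (hAM : ∀ i, i < r → ∀ y' : Site P (i + 1), ‖Aref i y'‖ ≤ M (i + 1) y')
    (hMa : ∀ i, i < r → ∀ y' : Site P (i + 1), 8 * M (i + 1) y' ≤ a)
    (hOa : ∀ i, i < r → ∀ y' : Site P (i + 1), 8 * O (i + 1) y' ≤ a)
    (hXO : ∀ i, i < r → ∀ (y' : Site P (i + 1)) (b : PBond P i), (blockOf b.src = y' ∨ blockOf b.src = y'.shift μ ∨ blockOf b.src = y'.shift ν ∨ blockOf b.src = (y'.shift μ).shift ν) →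
      ‖(((T4AxialGaugeSmallField.axialGauge (U i) (fun κ : Fin P.d => (((emb y' κ).val : ℕ) : ℤ) - (((P.L - 1) / 2 : ℕ) : ℤ)) (fun κ : Fin P.d => (((emb y' κ).val : ℕ) : ℤ) + (((if κ = μ then (P.L : ℤ) else 0) + (if κ = ν then (P.L : ℤ) else 0)) + (((P.L - 1) / 2 : ℕ) : ℤ)) + 1)) b.src : SU N) : Matrix (Fin N) (Fin N) ℂ) * ((X i b : (specialUnitaryLogChart (Fin N)).lie) : Matrix (Fin N) (Fin N) ℂ) * star (((T4AxialGaugeSmallField.axialGauge (U i) (fun κ : Fin P.d => (((emb y' κ).val : ℕ) : ℤ) - (((P.L - 1) / 2 : ℕ) : ℤ)) (fun κ : Fin P.d => (((emb y' κ).val : ℕ) : ℤ) + (((if κ = μ then (P.L : ℤ) else 0) + (if κ = ν then (P.L : ℤ) else 0)) + (((P.L - 1) / 2 : ℕ) : ℤ)) + 1)) b.src : SU N) : Matrix (Fin N) (Fin N) ℂ) - ((Aref i y' b.dir : (specialUnitaryLogChart (Fin N)).lie) : Matrix (Fin N) (Fin N) ℂ)‖ ≤ O (i + 1) y')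
    (ρ src : (i : ℕ) → Site P i → ℝ)
    (hρ : ρ = fun i x => ‖covWalkSum (U i) (fun b => ((X i b : (specialUnitaryLogChart (Fin N)).lie) : Matrix (Fin N) (Fin N) ℂ))
      (walk x [((μ, true) : Letter P.d), (ν, true), (μ, false), (ν, false)])‖)
    (hsrc : src = fun i x => (P.L : ℝ) * ((P.L : ℝ) * (2 * δ i * ((P.L : ℝ) + 2 * P.L + 2) * M i x)) + 48 * α i * ((P.L : ℝ) * M i x) +
            (2 * αp i * ((((P.d + 2) * P.L : ℕ) : ℝ) * M i x) + 24 * α i * ((((P.d + 2) * P.L : ℕ) : ℝ) * M i x)) +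
            4 * (404 * (((P.d + 2) * P.L : ℕ) : ℝ) * α i * M i x) + 4 * (8 * (54 * ((((P.d + 2) * P.L : ℕ) : ℝ) * (Real.exp a - 1))) * O i x ^ 2 / (a - M i x) ^ 2 +
        32 * (54 * ((((P.d + 2) * P.L : ℕ) : ℝ) * (Real.exp a - 1))) * O i x * M i x / a ^ 2 +
        ((((P.d + 2) * P.L : ℕ) : ℝ) * M i x) ^ 3 + 8 * (67 * ((((P.d + 2) * P.L : ℕ) : ℝ) * (((P.d - 1 : ℕ) : ℝ) * ((3 * P.L : ℕ) : ℝ) * δ i))) * M i x ^ 2 / a ^ 2) +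
            2 * δ i * ((P.L : ℝ) ^ 2 * M i x)) :
    ∀ i, i < r → ∀ y' : Site P (i + 1),
      ρ (i + 1) y' ≤ (Fintype.card (Idx P) : ℝ)⁻¹ *
          ∑ a ∈ (Finset.univ : Finset (Idx P)) ×ˢ (Finset.range P.L ×ˢ Finset.range P.L), ρ i (shiftN (shiftN (Site.blockSite y' a.1.1) μ a.2.1) ν a.2.2) +
        src (i + 1) y' := by
  have hr : r ≤ P.m + P.K := by omega
  exact FluctuationComparisonRegPrIntLS2BetaCoarseCurlRowsRem.rows_LL_tower_of_remainder_K5 hμν r hr U X hU hX α δ αp hα hα24 hαδ hδ hUs hαp M hM hXM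
    (fun (i : ℕ) (x : Site P i) => (8 * (54 * ((((P.d + 2) * P.L : ℕ) : ℝ) * (Real.exp a - 1))) * O i x ^ 2 / (a - M i x) ^ 2 +
        32 * (54 * ((((P.d + 2) * P.L : ℕ) : ℝ) * (Real.exp a - 1))) * O i x * M i x / a ^ 2 +
        ((((P.d + 2) * P.L : ℕ) : ℝ) * M i x) ^ 3 + 8 * (67 * ((((P.d + 2) * P.L : ℕ) : ℝ) * (((P.d - 1 : ℕ) : ℝ) * ((3 * P.L : ℕ) : ℝ) * δ i))) * M i x ^ 2 / a ^ 2))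
    (hR_cov r hr2 U X hρ0 hρr α δ hα hα4 hδ hUs hδℓ ha0 ha M O Aref hO0 hAM hMa hOa hXM hXO) ρ src hρ hsrc

end RowsCov

/-! ## §3 ★★★ The pairwise COVARIANT-oscillation edition (reference data chosen at the block centre) -/

section RowsCovOsc

/-- ★★★ **ROWS v2, COVARIANT, FROM THE PAIRWISE COVARIANT OSCILLATION** — §4 with `Aref i y′ κ := h_{i,y′}(emb y′)·↑(X i ⟨emb y′, κ⟩)·h_{i,y′}(emb y′)⋆` chosen inside: the letters
`Aref`∕`hAM`∕`hXO` become ONE letter `hOSC : ‖h(b₋)·↑(X i b)·h(b₋)⋆ − h(b′₋)·↑(X i b′)·h(b′₋)⋆‖ ≤ O (i+1) y′` for same-direction bonds `b, b′` issuing from the four corner blocks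
(`= ‖↑(X i b) − Ad_{h(b₋)⁻¹h(b′₋)}↑(X i b′)‖`, the background's parallel transport along the box comb).  Conclusion VERBATIM §4's. [cite: Balaban1985Averaging, Prop. 3 (121)-(126) p.36, Prop. 4 (128)-(135) pp.37-38; Balaban1987RG1, (0.3)-(0.4), (0.18) pp.252-255] -/
theorem rows_K5_cov_osc {μ ν : Fin P.d} (hμν : μ ≠ ν) (r : ℕ) (hr2 : r + 1 ≤ P.m + P.K)
    (U : (i : ℕ) → GaugeField P i (SU N)) (X : (i : ℕ) → PBond P i → (specialUnitaryLogChart (Fin N)).lie)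
    (hU : ∀ i, i < r → U (i + 1) = avgFun (expMeanLogSU (n := Fin N)) (U i))
    (hX : ∀ i, i < r → X (i + 1) = fun c : PBond P (i + 1) => (isChartRep_specialUnitaryGroup (n := Fin N)).logChart
        (avgFun (expMeanLogSU (n := Fin N)) (fun b => (isChartRep_specialUnitaryGroup (n := Fin N)).expChart (X i b) * U i b) c *
          (avgFun (expMeanLogSU (n := Fin N)) (U i) c)⁻¹))
    (α δ αp : ℕ → ℝ)
    (hα : ∀ i, i < r → ∀ (c : PBond P (i + 1)) (ι : Idx P), dist1 (loopHol (U i) c ι) ≤ α (i + 1))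
    (hα24 : ∀ i, i < r → α (i + 1) ≤ 1 / 24) (hαδ : ∀ i, i < r → α (i + 1) < deltaSU (Fin N))
    (hδ : ∀ i, i < r → 0 ≤ δ (i + 1)) (hUs : ∀ i, i < r → PlaqSmall (δ (i + 1)) (U i))
    (hαp : ∀ i, i < r → ∀ y' : Site P (i + 1),
      dist1 (holAt (avgFun (expMeanLogSU (n := Fin N)) (U i)) (walk y' [((μ, true) : Letter P.d), (ν, true), (μ, false), (ν, false)])) ≤ αp (i + 1))
    (M : (i : ℕ) → Site P i → ℝ) (hM : ∀ i, i < r → ∀ y' : Site P (i + 1), 0 ≤ M (i + 1) y')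
    (hXM : ∀ i, i < r → ∀ (y' : Site P (i + 1)) (b : PBond P i),
      (blockOf b.src = y' ∨ blockOf b.src = y'.shift μ ∨ blockOf b.src = y'.shift ν ∨ blockOf b.src = (y'.shift μ).shift ν) → ‖X i b‖ ≤ M (i + 1) y')
    {ρr : ℝ} (hρ0 : 0 < ρr) (hρr : ρr ≤ innerRadius (specialUnitaryLogChart (Fin N))) (hα4 : ∀ i, i < r → 4 * α (i + 1) ≤ ρr)
    (hδℓ : ∀ i, i < r → 100 * ((((P.d + 2) * P.L : ℕ) : ℝ) * (((P.d - 1 : ℕ) : ℝ) * ((3 * P.L : ℕ) : ℝ) * δ (i + 1))) ≤ ρr)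
    {a : ℝ} (ha0 : 0 < a) (ha : 100 * ((((P.d + 2) * P.L : ℕ) : ℝ) * (Real.exp a - 1)) ≤ ρr)
    (O : (i : ℕ) → Site P i → ℝ)
    (hO0 : ∀ i, i < r → ∀ y' : Site P (i + 1), 0 ≤ O (i + 1) y')
    (hMa : ∀ i, i < r → ∀ y' : Site P (i + 1), 8 * M (i + 1) y' ≤ a)
    (hOa : ∀ i, i < r → ∀ y' : Site P (i + 1), 8 * O (i + 1) y' ≤ a)
    (hOSC : ∀ i, i < r → ∀ (y' : Site P (i + 1)) (b b' : PBond P i), (blockOf b.src = y' ∨ blockOf b.src = y'.shift μ ∨ blockOf b.src = y'.shift ν ∨ blockOf b.src = (y'.shift μ).shift ν) →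
      (blockOf b'.src = y' ∨ blockOf b'.src = y'.shift μ ∨ blockOf b'.src = y'.shift ν ∨ blockOf b'.src = (y'.shift μ).shift ν) → b.dir = b'.dir →
      ‖(((T4AxialGaugeSmallField.axialGauge (U i) (fun κ : Fin P.d => (((emb y' κ).val : ℕ) : ℤ) - (((P.L - 1) / 2 : ℕ) : ℤ)) (fun κ : Fin P.d => (((emb y' κ).val : ℕ) : ℤ) + (((if κ = μ then (P.L : ℤ) else 0) + (if κ = ν then (P.L : ℤ) else 0)) + (((P.L - 1) / 2 : ℕ) : ℤ)) + 1)) b.src : SU N) : Matrix (Fin N) (Fin N) ℂ) * ((X i b : (specialUnitaryLogChart (Fin N)).lie) : Matrix (Fin N) (Fin N) ℂ) * star (((T4AxialGaugeSmallField.axialGauge (U i) (fun κ : Fin P.d => (((emb y' κ).val : ℕ) : ℤ) - (((P.L - 1) / 2 : ℕ) : ℤ)) (fun κ : Fin P.d => (((emb y' κ).val : ℕ) : ℤ) + (((if κ = μ then (P.L : ℤ) else 0) + (if κ = ν then (P.L : ℤ) else 0)) + (((P.L - 1) / 2 : ℕ) : ℤ)) + 1)) b.src : SU N) : Matrix (Fin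 N) (Fin N) ℂ) - (((T4AxialGaugeSmallField.axialGauge (U i) (fun κ : Fin P.d => (((emb y' κ).val : ℕ) : ℤ) - (((P.L - 1) / 2 : ℕ) : ℤ)) (fun κ : Fin P.d => (((emb y' κ).val : ℕ) : ℤ) + (((if κ = μ then (P.L : ℤ) else 0) + (if κ = ν then (P.L : ℤ) else 0)) + (((P.L - 1) / 2 : ℕ) : ℤ)) + 1)) b'.src : SU N) : Matrix (Fin N) (Fin N) ℂ) * ((X i b' : (specialUnitaryLogChart (Fin N)).lie) : Matrix (Fin N) (Fin N) ℂ) * star (((T4AxialGaugeSmallField.axialGauge (U i) (fun κ : Fin P.d => (((emb y' κ).val : ℕ) : ℤ) - (((P.L - 1) / 2 : ℕ) : ℤ)) (fun κ : Fin P.d => (((emb y' κ).val : ℕ) : ℤ) + (((if κ = μ then (P.L : ℤ) else 0) + (if κ = ν then (P.L : ℤ) else 0)) + (((P.L - 1) / 2 : ℕ) : ℤ)) + 1)) b'.src : SU N) : Matrix (Fin N) (Fin N) ℂ)‖ ≤ O (i + 1) y')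
    (ρ src : (i : ℕ) → Site P i → ℝ)
    (hρ : ρ = fun i x => ‖covWalkSum (U i) (fun b => ((X i b : (specialUnitaryLogChart (Fin N)).lie) : Matrix (Fin N) (Fin N) ℂ))
      (walk x [((μ, true) : Letter P.d), (ν, true), (μ, false), (ν, false)])‖)
    (hsrc : src = fun i x => (P.L : ℝ) * ((P.L : ℝ) * (2 * δ i * ((P.L : ℝ) + 2 * P.L + 2) * M i x)) + 48 * α i * ((P.L : ℝ) * M i x) +
            (2 * αp i * ((((P.d + 2) * P.L : ℕ) : ℝ) * M i x) + 24 * α i * ((((P.d + 2) * P.L : ℕ) : ℝ) * M i x)) +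
            4 * (404 * (((P.d + 2) * P.L : ℕ) : ℝ) * α i * M i x) + 4 * (8 * (54 * ((((P.d + 2) * P.L : ℕ) : ℝ) * (Real.exp a - 1))) * O i x ^ 2 / (a - M i x) ^ 2 +
        32 * (54 * ((((P.d + 2) * P.L : ℕ) : ℝ) * (Real.exp a - 1))) * O i x * M i x / a ^ 2 +
        ((((P.d + 2) * P.L : ℕ) : ℝ) * M i x) ^ 3 + 8 * (67 * ((((P.d + 2) * P.L : ℕ) : ℝ) * (((P.d - 1 : ℕ) : ℝ) * ((3 * P.L : ℕ) : ℝ) * δ i))) * M i x ^ 2 / a ^ 2) +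
            2 * δ i * ((P.L : ℝ) ^ 2 * M i x)) :
    ∀ i, i < r → ∀ y' : Site P (i + 1),
      ρ (i + 1) y' ≤ (Fintype.card (Idx P) : ℝ)⁻¹ *
          ∑ a ∈ (Finset.univ : Finset (Idx P)) ×ˢ (Finset.range P.L ×ˢ Finset.range P.L), ρ i (shiftN (shiftN (Site.blockSite y' a.1.1) μ a.2.1) ν a.2.2) +
        src (i + 1) y' := by
  refine rows_K5_cov hμν r hr2 U X hU hX α δ αp hα hα24 hαδ hδ hUs hαp M hM hXM hρ0 hρr hα4 hδℓ ha0 ha O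
    (fun i y' κ => ⟨(((T4AxialGaugeSmallField.axialGauge (U i) (fun κ : Fin P.d => (((emb y' κ).val : ℕ) : ℤ) - (((P.L - 1) / 2 : ℕ) : ℤ)) (fun κ : Fin P.d => (((emb y' κ).val : ℕ) : ℤ) + (((if κ = μ then (P.L : ℤ) else 0) + (if κ = ν then (P.L : ℤ) else 0)) + (((P.L - 1) / 2 : ℕ) : ℤ)) + 1)) (emb y') : SU N) : Matrix (Fin N) (Fin N) ℂ) * ((X i ⟨emb y', κ⟩ : (specialUnitaryLogChart (Fin N)).lie) : Matrix (Fin N) (Fin N) ℂ) * star (((T4AxialGaugeSmallField.axialGauge (U i) (fun κ : Fin P.d => (((emb y' κ).val : ℕ) : ℤ) - (((P.L - 1) / 2 : ℕ) : ℤ)) (fun κ : Fin P.d => (((emb y' κ).val : ℕ) : ℤ) + (((if κ = μ then (P.L : ℤ) else 0) + (if κ = ν then (P.L : ℤ) else 0)) + (((P.L - 1) / 2 : ℕ) : ℤ)) + 1)) (emb y') : SU N) : Matrix (Fin N) (Fin N) ℂ),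
      conj_mem_lie ((T4AxialGaugeSmallField.axialGauge (U i) (fun κ : Fin P.d => (((emb y' κ).val : ℕ) : ℤ) - (((P.L - 1) / 2 : ℕ) : ℤ)) (fun κ : Fin P.d => (((emb y' κ).val : ℕ) : ℤ) + (((if κ = μ then (P.L : ℤ) else 0) + (if κ = ν then (P.L : ℤ) else 0)) + (((P.L - 1) / 2 : ℕ) : ℤ)) + 1)) (emb y')) (X i ⟨emb y', κ⟩)⟩)
    hO0 (fun i hi y' => ?_) hMa hOa (fun i hi y' b hb => ?_) ρ src hρ hsrc
  · refine (pi_norm_le_iff_of_nonneg (hM i hi y')).2 fun κ => ?_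
    rw [← Submodule.norm_coe]
    exact (norm_coe_conj_le _ _).trans (by rw [Submodule.norm_coe]; exact hXM i hi y' ⟨emb y', κ⟩ (Or.inl (Site.blockOf_emb (by omega) y')))
  · exact hOSC i hi y' b ⟨emb y', b.dir⟩ hb (Or.inl (Site.blockOf_emb (by omega) y')) rfl

end RowsCovOsc

end Summit.QuantumFields.YangMills.Theorems.FluctuationComparisonRegPrIntLS2BetaCoarseCurlRowsCovariant

end
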